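import Summits.CriticalPhenomena.PercolationContinuityZ3.Theorems.PercNearOneGluingNoHeavyLowerTailFKStarH
import Summits.CriticalPhenomena.PercolationContinuityZ3.Theorems.PercNearOneGluingNoHeavyLowerTailFKHullPortTALayer
import HarnessLib

/-!
# FK sub-lane: Lemma (★^H) for `φ_{𝐩,q}` for every monotone test function (abstract layer cake)

Support file (`--supports stmt-CriticalPhenomena-4575`), FK sub-lane `prim-bschramm-fk-2` (gen 3); builds on p205010 (kernel theorem,
internal audit signed; external expert review pending).  No definitions, no named facts, no sorries; standard axioms.

* `FK.layerCake_le` — the layer-cake transfer principle used throughout the cell (prove-5's `HullPort.taQ_nonneg_of_PvI`, this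
  seat's `FK.taB_singleton_le_of_monotone`), stated once abstractly: if two functionals `L, R` of a test function on the finite
  lattice `Set (Sym2 V)` are linear, vanish on constants, and satisfy `L(1_U) ≤ R(1_U)` for every increasing family `U`, then
  `L(g) ≤ R(g)` for every monotone `g` (peel the least positive value of `g − g(∅)`).
* `FK.starH_rc` — hp-8's Lemma (★^H) ((K7) of PROOF-S5-ALL-R) for `φ_{𝐩,q}`, `q ≥ 1`, for EVERY monotone test function `Ψ` of
  `C_x`: `Y^H(N)·φ(S ↮ v) ≤ φ(S ↮ v, N ↮ v)·Cov(Ψ(C_x), 1{S ↔ v})`, from the indicator case `FK.starH_indicator_rc`.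
[cite: Gladkov2024, Thm. 3.2 (p. 4)] [cite: VandenbergHaggstromKahn2005, Thm. 1.4 (p. 7), §2.1 Lemmas 2.3–2.4 (p. 10)]
[cite: Grimmett2006, Thm. (3.8)(b) (p. 39)]
-/

noncomputable section

namespace Summit.CriticalPhenomena.PercolationContinuityZ3.Theorems.FK

open MeasureTheory Set
open Literature.Probability.LatticeModels Literature.Probability.Percolation
open Literature.Probability.Percolation.DecisionTree (ind ind_of_mem ind_of_not_mem ind_nonneg)
open Literature.Probability.Percolation.BHK2006 (rcMass rcMass_nonneg sum_rcMass delW rcMeasureW_real_eq_sum_rcMass)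
open Summit.CriticalPhenomena.PercolationContinuityZ3.Theorems.HullPort (cut)
open scoped Classical

variable {V : Type*} [Fintype V]

/-! ### The abstract layer cake -/

omit [Fintype V] in
/-- **Layer-cake transfer.**  Let `L, R` be functionals of a test function `g : Set ι → ℝ` on a finite type of edge sets which are
linear (`L(c·g₁ + g₂) = c·L(g₁) + L(g₂)`) and vanish on constants.  If `L(1_U) ≤ R(1_U)` for every increasing family `U`, then
`L(g) ≤ R(g)` for every monotone `g`: a monotone `g` is `g(∅) + Σ_k m_k 1_{U_k}` with `m_k > 0`, `U_k = {g − (peeled part) > 0}`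
increasing. [folklore] -/
theorem layerCake_le {ι : Type*} [Fintype ι] (L R : (Set ι → ℝ) → ℝ)
    (hL : ∀ (c : ℝ) (g₁ g₂ : Set ι → ℝ), L (fun C => c * g₁ C + g₂ C) = c * L g₁ + L g₂)
    (hR : ∀ (c : ℝ) (g₁ g₂ : Set ι → ℝ), R (fun C => c * g₁ C + g₂ C) = c * R g₁ + R g₂)
    (hLc : ∀ c : ℝ, L (fun _ => c) = 0) (hRc : ∀ c : ℝ, R (fun _ => c) = 0)
    (hind : ∀ U : Set (Set ι), IsUpperSet U → L (fun C => ind U C) ≤ R (fun C => ind U C))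
    (g : Set ι → ℝ) (hg : Monotone g) : L g ≤ R g := by
  classical
  -- nonnegative monotone test functions, by induction on the size of the support
  have Hpos : ∀ (n : ℕ) (g : Set ι → ℝ), Monotone g → (∀ C, 0 ≤ g C) →
      (Finset.univ.filter (fun C : Set ι => 0 < g C)).card = n → L g ≤ R g := by
    intro n
    induction n using Nat.strong_induction_on with
    | _ n ih =>
    intro g hg hg0 hn
    set S : Finset (Set ι) := Finset.univ.filter (fun C : Set ι => 0 < g C) with hS
    by_cases hS0 : S = ∅
    · have hg00 : ∀ C, g C = 0 := by
        intro C
        have hC : C ∉ S := by rw [hS0]; exact Finset.notMem_empty C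
        have hC' : ¬ 0 < g C := fun h => hC (Finset.mem_filter.2 ⟨Finset.mem_univ C, h⟩)
        exact le_antisymm (not_lt.1 hC') (hg0 C)
      have hgz : g = fun _ => (0 : ℝ) := by funext C; exact hg00 C
      rw [hgz, hLc, hRc]
    · have hSne : S.Nonempty := Finset.nonempty_iff_ne_empty.2 hS0
      set m : ℝ := S.inf' hSne g with hm
      have hmpos : 0 < m := by
        obtain ⟨C, hC, hCm⟩ := Finset.exists_mem_eq_inf' hSne g
        rw [hm, hCm]; exact (Finset.mem_filter.1 hC).2
      have hmle : ∀ C, 0 < g C → m ≤ g C := fun C hC =>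
        Finset.inf'_le g (Finset.mem_filter.2 ⟨Finset.mem_univ C, hC⟩)
      set U : Set (Set ι) := {C | 0 < g C} with hU
      have hUup : IsUpperSet U := fun C C' hCC' (hC : 0 < g C) => lt_of_lt_of_le hC (hg hCC')
      set g' : Set ι → ℝ := fun C => g C - m * ind U C with hg'
      have hg'0 : ∀ C, 0 ≤ g' C := by
        intro C; simp only [hg']
        by_cases hC : 0 < g C
        · rw [ind_of_mem (show C ∈ U from hC)]; linarith [hmle C hC]
        · rw [ind_of_not_mem (show C ∉ U from hC)]; linarith [hg0 C]
      have hg'mono : Monotone g' := by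
        intro C C' hCC'
        simp only [hg']
        by_cases hC : 0 < g C
        · have hC' : 0 < g C' := lt_of_lt_of_le hC (hg hCC')
          rw [ind_of_mem (show C ∈ U from hC), ind_of_mem (show C' ∈ U from hC')]
          linarith [hg hCC']
        · rw [ind_of_not_mem (show C ∉ U from hC)]
          have : g C = 0 := le_antisymm (not_lt.1 hC) (hg0 C)
          rw [this]; linarith [hg'0 C']
      obtain ⟨C₀, hC₀S, hC₀m⟩ := Finset.exists_mem_eq_inf' hSne g
      have hlt : (Finset.univ.filter (fun C : Set ι => 0 < g' C)).card < n := by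
        rw [← hn]
        apply Finset.card_lt_card
        refine ⟨fun C hC => ?_, fun hsub => ?_⟩
        · rw [Finset.mem_filter] at hC ⊢
          refine ⟨hC.1, ?_⟩
          by_contra hgC
          have : g' C = 0 := by
            simp only [hg']; rw [ind_of_not_mem (show C ∉ U from hgC)]
            have : g C = 0 := le_antisymm (not_lt.1 hgC) (hg0 C)
            rw [this]; ring
          linarith [hC.2]
        · have h1 := (Finset.mem_filter.1 (hsub hC₀S)).2
          have h2 : g' C₀ = 0 := by
            simp only [hg']
            rw [ind_of_mem (show C₀ ∈ U from (Finset.mem_filter.1 hC₀S).2), ← hC₀m, hm]; ring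
          linarith
      have ih' := ih _ hlt g' hg'mono hg'0 rfl
      have hdec : g = fun C => m * (fun C : Set ι => ind U C) C + g' C := by
        funext C; simp only [hg']; ring
      rw [hdec, hL, hR]
      exact add_le_add (mul_le_mul_of_nonneg_left (hind U hUup) hmpos.le) ih'
  -- general monotone `g`: subtract `g ∅`
  have hmin : ∀ C, g ∅ ≤ g C := fun C => hg (Set.empty_subset C)
  have hdec : g = fun C => (1 : ℝ) * (fun C => g C - g ∅) C + (fun _ => g ∅) C := by
    funext C; ring
  have key := Hpos _ (fun C => g C - g ∅) (fun C C' h => by dsimp only; linarith [hg h])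
    (fun C => by linarith [hmin C]) rfl
  have e1 := hL 1 (fun C => g C - g ∅) (fun _ => g ∅)
  have e2 := hR 1 (fun C => g C - g ∅) (fun _ => g ∅)
  rw [hLc] at e1
  rw [hRc] at e2
  calc L g = L (fun C => (1 : ℝ) * (fun C => g C - g ∅) C + (fun _ => g ∅) C) := by rw [← hdec]
    _ = L (fun C => g C - g ∅) := by rw [e1]; ring
    _ ≤ R (fun C => g C - g ∅) := key
    _ = R (fun C => (1 : ℝ) * (fun C => g C - g ∅) C + (fun _ => g ∅) C) := by rw [e2]; ring
    _ = R g := by rw [← hdec]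

/-! ### (★^H) for every monotone test function -/

/-- **Lemma (★^H) for `φ_{𝐩,q}`, `q ≥ 1`, every monotone test function `Ψ` of `C_x`** (hp-8, PROOF-S5-ALL-R (K7), for the
random-cluster measure): for `x ∈ S`, an observer `v`, a source set `N`,
`Y^H(N)·φ(S ↮ v) ≤ φ(S ↮ v, N ↮ v)·Cov(Ψ(C_x), 1{S ↔ v})` with
`Y^H(N) = Σ_ω φ{ω} 1{N ↮ x, N ↮ v}(ω)·Cov_{φ_{u − cut_N(ω)}}(Ψ(C_x), 1{S ↔ v})` — both sides are linear in `Ψ` and vanish on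
constants, so the indicator case `FK.starH_indicator_rc` suffices (`FK.layerCake_le`).
[cite: Gladkov2024, Thm. 3.2 (p. 4)] [cite: VandenbergHaggstromKahn2005, Thm. 1.4 (p. 7), §2.1 Lemmas 2.3–2.4 (p. 10)]
[cite: Grimmett2006, Thm. (3.8)(b) (p. 39)] -/
theorem starH_rc (u : Sym2 V → unitInterval) {q : ℝ} (hq : 1 ≤ q) {x : V} (v : V) {S : Set V} (hxS : x ∈ S)
    (N : Set V) (Ψ : Set (Sym2 V) → ℝ) (hΨ : Monotone Ψ) :
    (∑ ω, rcMass u q ω * (ind {ω : BondConfig V | (∀ n ∈ N, ¬ (openGraph ω).Reachable n x) ∧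
          ∀ n ∈ N, ¬ (openGraph ω).Reachable n v} ω *
        ((∑ η, rcMass (delW u (cut N ω)) q η * (Ψ (openEdgeCluster η x) *
            ind {ζ : BondConfig V | ∃ s ∈ S, (openGraph ζ).Reachable s v} η)) -
          (∑ η, rcMass (delW u (cut N ω)) q η * Ψ (openEdgeCluster η x)) *
            (∑ η, rcMass (delW u (cut N ω)) q η * ind {ζ : BondConfig V | ∃ s ∈ S, (openGraph ζ).Reachable s v} η)))) *
        (rcMeasureW u q ∅).real {ζ : BondConfig V | ∃ s ∈ S, (openGraph ζ).Reachable s v}ᶜ ≤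
      (rcMeasureW u q ∅).real ({ζ : BondConfig V | ∃ s ∈ S, (openGraph ζ).Reachable s v}ᶜ ∩
          {ζ : BondConfig V | ∃ n ∈ N, (openGraph ζ).Reachable n v}ᶜ) *
        ((∑ ω, rcMass u q ω * (Ψ (openEdgeCluster ω x) * ind {ζ : BondConfig V | ∃ s ∈ S, (openGraph ζ).Reachable s v} ω)) -
          (∑ ω, rcMass u q ω * Ψ (openEdgeCluster ω x)) *
            (rcMeasureW u q ∅).real {ζ : BondConfig V | ∃ s ∈ S, (openGraph ζ).Reachable s v}) := by
  classical
  have hq0 : 0 < q := one_pos.trans_le hq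
  set Y : Set (BondConfig V) := {ζ : BondConfig V | ∃ s ∈ S, (openGraph ζ).Reachable s v} with hY
  set G : Set (BondConfig V) := {ω : BondConfig V | (∀ n ∈ N, ¬ (openGraph ω).Reachable n x) ∧
    ∀ n ∈ N, ¬ (openGraph ω).Reachable n v} with hG
  set K : ℝ := (rcMeasureW u q ∅).real (Yᶜ ∩ {ζ : BondConfig V | ∃ n ∈ N, (openGraph ζ).Reachable n v}ᶜ) with hK
  -- the two functionals
  set L : (Set (Sym2 V) → ℝ) → ℝ := fun g =>
    (∑ ω, rcMass u q ω * (ind G ω *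
      ((∑ η, rcMass (delW u (cut N ω)) q η * (g (openEdgeCluster η x) * ind Y η)) -
        (∑ η, rcMass (delW u (cut N ω)) q η * g (openEdgeCluster η x)) *
          (∑ η, rcMass (delW u (cut N ω)) q η * ind Y η)))) * (rcMeasureW u q ∅).real Yᶜ with hLdef
  set R : (Set (Sym2 V) → ℝ) → ℝ := fun g =>
    K * ((∑ ω, rcMass u q ω * (g (openEdgeCluster ω x) * ind Y ω)) -
      (∑ ω, rcMass u q ω * g (openEdgeCluster ω x)) * (rcMeasureW u q ∅).real Y) with hRdef
  show L Ψ ≤ R Ψ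
  -- world covariances are linear and vanish on constants
  have hcov_lin : ∀ (m : BondConfig V → ℝ) (c : ℝ) (g₁ g₂ : Set (Sym2 V) → ℝ) (t : ℝ),
      (∑ η, m η * ((c * g₁ (openEdgeCluster η x) + g₂ (openEdgeCluster η x)) * ind Y η)) -
        (∑ η, m η * (c * g₁ (openEdgeCluster η x) + g₂ (openEdgeCluster η x))) * t =
      c * ((∑ η, m η * (g₁ (openEdgeCluster η x) * ind Y η)) - (∑ η, m η * g₁ (openEdgeCluster η x)) * t) +
        ((∑ η, m η * (g₂ (openEdgeCluster η x) * ind Y η)) - (∑ η, m η * g₂ (openEdgeCluster η x)) * t) := by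
    intro m c g₁ g₂ t
    have e1 : ∑ η, m η * ((c * g₁ (openEdgeCluster η x) + g₂ (openEdgeCluster η x)) * ind Y η) =
        c * ∑ η, m η * (g₁ (openEdgeCluster η x) * ind Y η) + ∑ η, m η * (g₂ (openEdgeCluster η x) * ind Y η) := by
      rw [Finset.mul_sum, ← Finset.sum_add_distrib]
      refine Finset.sum_congr rfl fun η _ => ?_; ring
    have e2 : ∑ η, m η * (c * g₁ (openEdgeCluster η x) + g₂ (openEdgeCluster η x)) =
        c * ∑ η, m η * g₁ (openEdgeCluster η x) + ∑ η, m η * g₂ (openEdgeCluster η x) := by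
      rw [Finset.mul_sum, ← Finset.sum_add_distrib]
      refine Finset.sum_congr rfl fun η _ => ?_; ring
    rw [e1, e2]; ring
  have hcov_const : ∀ (w' : Sym2 V → unitInterval) (c t : ℝ), (∑ η, rcMass w' q η * ind Y η) = t →
      (∑ η, rcMass w' q η * (c * ind Y η)) - (∑ η, rcMass w' q η * c) * t = 0 := by
    intro w' c t ht
    have e1 : ∑ η, rcMass w' q η * (c * ind Y η) = c * ∑ η, rcMass w' q η * ind Y η := by
      rw [Finset.mul_sum]; refine Finset.sum_congr rfl fun η _ => ?_; ring
    have e2 : ∑ η, rcMass w' q η * c = c := by rw [← Finset.sum_mul, sum_rcMass _ hq0, one_mul]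
    rw [e1, e2, ht]; ring
  have hL : ∀ (c : ℝ) (g₁ g₂ : Set (Sym2 V) → ℝ), L (fun C => c * g₁ C + g₂ C) = c * L g₁ + L g₂ := by
    intro c g₁ g₂
    simp only [hLdef]
    have : ∀ ω : BondConfig V, rcMass u q ω * (ind G ω *
        ((∑ η, rcMass (delW u (cut N ω)) q η * ((c * g₁ (openEdgeCluster η x) + g₂ (openEdgeCluster η x)) * ind Y η)) -
          (∑ η, rcMass (delW u (cut N ω)) q η * (c * g₁ (openEdgeCluster η x) + g₂ (openEdgeCluster η x))) *
            ∑ η, rcMass (delW u (cut N ω)) q η * ind Y η)) =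
        c * (rcMass u q ω * (ind G ω *
          ((∑ η, rcMass (delW u (cut N ω)) q η * (g₁ (openEdgeCluster η x) * ind Y η)) -
            (∑ η, rcMass (delW u (cut N ω)) q η * g₁ (openEdgeCluster η x)) * ∑ η, rcMass (delW u (cut N ω)) q η * ind Y η))) +
        rcMass u q ω * (ind G ω *
          ((∑ η, rcMass (delW u (cut N ω)) q η * (g₂ (openEdgeCluster η x) * ind Y η)) -
            (∑ η, rcMass (delW u (cut N ω)) q η * g₂ (openEdgeCluster η x)) * ∑ η, rcMass (delW u (cut N ω)) q η * ind Y η)) := by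
      intro ω
      rw [hcov_lin]; ring
    simp only [this, Finset.sum_add_distrib, ← Finset.mul_sum]
    ring
  have hR : ∀ (c : ℝ) (g₁ g₂ : Set (Sym2 V) → ℝ), R (fun C => c * g₁ C + g₂ C) = c * R g₁ + R g₂ := by
    intro c g₁ g₂
    simp only [hRdef]
    rw [hcov_lin]; ring
  have hLc : ∀ c : ℝ, L (fun _ => c) = 0 := by
    intro c
    simp only [hLdef]
    have : ∀ ω : BondConfig V, rcMass u q ω * (ind G ω *
        ((∑ η, rcMass (delW u (cut N ω)) q η * (c * ind Y η)) -
          (∑ η, rcMass (delW u (cut N ω)) q η * c) * ∑ η, rcMass (delW u (cut N ω)) q η * ind Y η)) = 0 := by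
      intro ω
      rw [hcov_const (delW u (cut N ω)) c _ rfl]; ring
    simp only [this, Finset.sum_const_zero, zero_mul]
  have hRc : ∀ c : ℝ, R (fun _ => c) = 0 := by
    intro c
    simp only [hRdef]
    rw [hcov_const u c _ (rcMeasureW_real_eq_sum_rcMass u hq0 Y).symm]; ring
  have hind : ∀ U : Set (Set (Sym2 V)), IsUpperSet U → L (fun C => ind U C) ≤ R (fun C => ind U C) := by
    intro U hU
    have h := starH_indicator_rc u hq v hxS N U hU
    have hiU : (fun C => ind U C) = U.indicator (1 : Set (Sym2 V) → ℝ) := ind_eq_indicator_one U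
    simp only [hLdef, hRdef, hiU]
    have eA : ∑ ω, rcMass u q ω * (U.indicator (1 : Set (Sym2 V) → ℝ) (openEdgeCluster ω x) * ind Y ω) =
        (rcMeasureW u q ∅).real ({η : BondConfig V | openEdgeCluster η x ∈ U} ∩ Y) := by
      rw [rcMeasureW_real_eq_sum_rcMass u hq0]
      refine Finset.sum_congr rfl fun ω _ => ?_
      rw [indicator_one_openEdgeCluster, BHK2006.ind_inter]
    have eB : ∑ ω, rcMass u q ω * U.indicator (1 : Set (Sym2 V) → ℝ) (openEdgeCluster ω x) =
        (rcMeasureW u q ∅).real {η : BondConfig V | openEdgeCluster η x ∈ U} := by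
      rw [rcMeasureW_real_eq_sum_rcMass u hq0]
      refine Finset.sum_congr rfl fun ω _ => ?_
      rw [indicator_one_openEdgeCluster]
    rw [eA, eB]
    exact h
  exact layerCake_le L R hL hR hLc hRc hind Ψ hΨ

/-- **`Y^H(N) ≤ Cov(Ψ(C_x), 1{S ↔ v})` for `φ_{𝐩,q}`, `q ≥ 1`, every monotone `Ψ`** (PROOF-S5-ALL-R (K7) Corollary, for the
random-cluster measure): layer cake over `FK.starH_le_cov_indicator_rc`.
[cite: Gladkov2024, Thm. 3.2 (p. 4)] [cite: VandenbergHaggstromKahn2005, Thm. 1.4 (p. 7), §2.1 Lemmas 2.3–2.4 (p. 10)]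
[cite: Grimmett2006, Thm. (3.8)(b) (p. 39)] -/
theorem starH_le_cov_rc (u : Sym2 V → unitInterval) {q : ℝ} (hq : 1 ≤ q) (x v : V) (S N : Set V)
    (Ψ : Set (Sym2 V) → ℝ) (hΨ : Monotone Ψ) :
    (∑ ω, rcMass u q ω * (ind {ω : BondConfig V | (∀ n ∈ N, ¬ (openGraph ω).Reachable n x) ∧
          ∀ n ∈ N, ¬ (openGraph ω).Reachable n v} ω *
        ((∑ η, rcMass (delW u (cut N ω)) q η * (Ψ (openEdgeCluster η x) *
            ind {ζ : BondConfig V | ∃ s ∈ S, (openGraph ζ).Reachable s v} η)) -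
          (∑ η, rcMass (delW u (cut N ω)) q η * Ψ (openEdgeCluster η x)) *
            (∑ η, rcMass (delW u (cut N ω)) q η * ind {ζ : BondConfig V | ∃ s ∈ S, (openGraph ζ).Reachable s v} η)))) ≤
      (∑ ω, rcMass u q ω * (Ψ (openEdgeCluster ω x) * ind {ζ : BondConfig V | ∃ s ∈ S, (openGraph ζ).Reachable s v} ω)) -
        (∑ ω, rcMass u q ω * Ψ (openEdgeCluster ω x)) *
          (rcMeasureW u q ∅).real {ζ : BondConfig V | ∃ s ∈ S, (openGraph ζ).Reachable s v} := by
  classical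
  have hq0 : 0 < q := one_pos.trans_le hq
  set Y : Set (BondConfig V) := {ζ : BondConfig V | ∃ s ∈ S, (openGraph ζ).Reachable s v} with hY
  set G : Set (BondConfig V) := {ω : BondConfig V | (∀ n ∈ N, ¬ (openGraph ω).Reachable n x) ∧
    ∀ n ∈ N, ¬ (openGraph ω).Reachable n v} with hG
  -- the two functionals
  set L : (Set (Sym2 V) → ℝ) → ℝ := fun g =>
    (∑ ω, rcMass u q ω * (ind G ω *
      ((∑ η, rcMass (delW u (cut N ω)) q η * (g (openEdgeCluster η x) * ind Y η)) -
        (∑ η, rcMass (delW u (cut N ω)) q η * g (openEdgeCluster η x)) *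
          (∑ η, rcMass (delW u (cut N ω)) q η * ind Y η)))) with hLdef
  set R : (Set (Sym2 V) → ℝ) → ℝ := fun g =>
    (∑ ω, rcMass u q ω * (g (openEdgeCluster ω x) * ind Y ω)) -
      (∑ ω, rcMass u q ω * g (openEdgeCluster ω x)) * (rcMeasureW u q ∅).real Y with hRdef
  show L Ψ ≤ R Ψ
  -- world covariances are linear and vanish on constants
  have hcov_lin : ∀ (m : BondConfig V → ℝ) (c : ℝ) (g₁ g₂ : Set (Sym2 V) → ℝ) (t : ℝ),
      (∑ η, m η * ((c * g₁ (openEdgeCluster η x) + g₂ (openEdgeCluster η x)) * ind Y η)) -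
        (∑ η, m η * (c * g₁ (openEdgeCluster η x) + g₂ (openEdgeCluster η x))) * t =
      c * ((∑ η, m η * (g₁ (openEdgeCluster η x) * ind Y η)) - (∑ η, m η * g₁ (openEdgeCluster η x)) * t) +
        ((∑ η, m η * (g₂ (openEdgeCluster η x) * ind Y η)) - (∑ η, m η * g₂ (openEdgeCluster η x)) * t) := by
    intro m c g₁ g₂ t
    have e1 : ∑ η, m η * ((c * g₁ (openEdgeCluster η x) + g₂ (openEdgeCluster η x)) * ind Y η) =
        c * ∑ η, m η * (g₁ (openEdgeCluster η x) * ind Y η) + ∑ η, m η * (g₂ (openEdgeCluster η x) * ind Y η) := by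
      rw [Finset.mul_sum, ← Finset.sum_add_distrib]
      refine Finset.sum_congr rfl fun η _ => ?_; ring
    have e2 : ∑ η, m η * (c * g₁ (openEdgeCluster η x) + g₂ (openEdgeCluster η x)) =
        c * ∑ η, m η * g₁ (openEdgeCluster η x) + ∑ η, m η * g₂ (openEdgeCluster η x) := by
      rw [Finset.mul_sum, ← Finset.sum_add_distrib]
      refine Finset.sum_congr rfl fun η _ => ?_; ring
    rw [e1, e2]; ring
  have hcov_const : ∀ (w' : Sym2 V → unitInterval) (c t : ℝ), (∑ η, rcMass w' q η * ind Y η) = t →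
      (∑ η, rcMass w' q η * (c * ind Y η)) - (∑ η, rcMass w' q η * c) * t = 0 := by
    intro w' c t ht
    have e1 : ∑ η, rcMass w' q η * (c * ind Y η) = c * ∑ η, rcMass w' q η * ind Y η := by
      rw [Finset.mul_sum]; refine Finset.sum_congr rfl fun η _ => ?_; ring
    have e2 : ∑ η, rcMass w' q η * c = c := by rw [← Finset.sum_mul, sum_rcMass _ hq0, one_mul]
    rw [e1, e2, ht]; ring
  have hL : ∀ (c : ℝ) (g₁ g₂ : Set (Sym2 V) → ℝ), L (fun C => c * g₁ C + g₂ C) = c * L g₁ + L g₂ := by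
    intro c g₁ g₂
    simp only [hLdef]
    have : ∀ ω : BondConfig V, rcMass u q ω * (ind G ω *
        ((∑ η, rcMass (delW u (cut N ω)) q η * ((c * g₁ (openEdgeCluster η x) + g₂ (openEdgeCluster η x)) * ind Y η)) -
          (∑ η, rcMass (delW u (cut N ω)) q η * (c * g₁ (openEdgeCluster η x) + g₂ (openEdgeCluster η x))) *
            ∑ η, rcMass (delW u (cut N ω)) q η * ind Y η)) =
        c * (rcMass u q ω * (ind G ω *
          ((∑ η, rcMass (delW u (cut N ω)) q η * (g₁ (openEdgeCluster η x) * ind Y η)) -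
            (∑ η, rcMass (delW u (cut N ω)) q η * g₁ (openEdgeCluster η x)) * ∑ η, rcMass (delW u (cut N ω)) q η * ind Y η))) +
        rcMass u q ω * (ind G ω *
          ((∑ η, rcMass (delW u (cut N ω)) q η * (g₂ (openEdgeCluster η x) * ind Y η)) -
            (∑ η, rcMass (delW u (cut N ω)) q η * g₂ (openEdgeCluster η x)) * ∑ η, rcMass (delW u (cut N ω)) q η * ind Y η)) := by
      intro ω
      rw [hcov_lin]; ring
    simp only [this, Finset.sum_add_distrib, ← Finset.mul_sum]
  have hR : ∀ (c : ℝ) (g₁ g₂ : Set (Sym2 V) → ℝ), R (fun C => c * g₁ C + g₂ C) = c * R g₁ + R g₂ := by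
    intro c g₁ g₂
    simp only [hRdef]
    rw [hcov_lin]
  have hLc : ∀ c : ℝ, L (fun _ => c) = 0 := by
    intro c
    simp only [hLdef]
    have : ∀ ω : BondConfig V, rcMass u q ω * (ind G ω *
        ((∑ η, rcMass (delW u (cut N ω)) q η * (c * ind Y η)) -
          (∑ η, rcMass (delW u (cut N ω)) q η * c) * ∑ η, rcMass (delW u (cut N ω)) q η * ind Y η)) = 0 := by
      intro ω
      rw [hcov_const (delW u (cut N ω)) c _ rfl]; ring
    simp only [this, Finset.sum_const_zero]
  have hRc : ∀ c : ℝ, R (fun _ => c) = 0 := by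
    intro c
    simp only [hRdef]
    exact hcov_const u c _ (rcMeasureW_real_eq_sum_rcMass u hq0 Y).symm
  have hind : ∀ U : Set (Set (Sym2 V)), IsUpperSet U → L (fun C => ind U C) ≤ R (fun C => ind U C) := by
    intro U hU
    have h := starH_le_cov_indicator_rc u hq x v S N U hU
    have hiU : (fun C => ind U C) = U.indicator (1 : Set (Sym2 V) → ℝ) := ind_eq_indicator_one U
    simp only [hLdef, hRdef, hiU]
    have eA : ∑ ω, rcMass u q ω * (U.indicator (1 : Set (Sym2 V) → ℝ) (openEdgeCluster ω x) * ind Y ω) =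
        (rcMeasureW u q ∅).real ({η : BondConfig V | openEdgeCluster η x ∈ U} ∩ Y) := by
      rw [rcMeasureW_real_eq_sum_rcMass u hq0]
      refine Finset.sum_congr rfl fun ω _ => ?_
      rw [indicator_one_openEdgeCluster, BHK2006.ind_inter]
    have eB : ∑ ω, rcMass u q ω * U.indicator (1 : Set (Sym2 V) → ℝ) (openEdgeCluster ω x) =
        (rcMeasureW u q ∅).real {η : BondConfig V | openEdgeCluster η x ∈ U} := by
      rw [rcMeasureW_real_eq_sum_rcMass u hq0]
      refine Finset.sum_congr rfl fun ω _ => ?_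
      rw [indicator_one_openEdgeCluster]
    rw [eA, eB]
    exact h
  exact layerCake_le L R hL hR hLc hRc hind Ψ hΨ

end Summit.CriticalPhenomena.PercolationContinuityZ3.Theorems.FK

end
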